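import Summits.CriticalPhenomena.PercolationContinuityZ3.Theorems.PercNearOneGluingNoHeavyPcintWinKernelFast
import Summits.CriticalPhenomena.PercolationContinuityZ3.Theorems.PercNearOneGluingNoHeavyPcintChordRandWindowCert
import HarnessLib

/-!
# PCINT lane, kernel window certificates in general dimension — integer weights and the two generic bound theorems

Cell `prim-pcint`, seat `prim-pcint-2` (gen 2); memo `run/shared/lean/prim/pcint/REDUCTIONS.md` §R2, §B2r.6, §B3r.7,
INTERVAL-PLAN §14.  Does NOT build on p205010.  On top of the computable layer `…PcintWinKernel` (`WinK.okc`, `cc`,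
`okN`, `gN`, `cN`, coding, table lookup) and its one-pass evaluation `…PcintWinKernelFast` this file fixes the INTEGER form of the B3r / B2r window certificates used by
every kernel instance `d = 4, 5, 6`:
* constants `p = pn/10^4`, (B3r) `s = s̄ = S/10^4 ≥ √(1-p²)`, refund `r = R/10^4` (`S R ≥ 10^8`, `(10^4-pn) R ≤ 10^8`),
  `κ̄ = (10^4+S)/(2·10^4)`; (B2r) `q = q̄ = Q/10^4` with `Q^{2d-1} ≥ (10^4-pn)·10^{4(2d-2)}`, `κ̄ = (10^4+Q)/(2·10^4)`;
* scaled weights `termB`, `termS` (natural numbers; `weightB_mul_den`, `weightS_mul_den`: they are EXACTLY the real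
  transition weights times the common denominator), rows `rowB`, `rowS`, and the per-code checks `rowOKB`, `rowOKS`
  (`10^5 · row ≤ lamN · DEN · v`, i.e. the Collatz–Wielandt inequality with `λ = lamN/10^5`);
* **`le_criticalProb_of_checkB`**, **`le_siteCriticalProb_of_checkS`**: if the check holds on all codes `< (2d)^{m+1}`
  (to be discharged by `decide +kernel` in chunks) and the elementary integer side conditions hold, then
  `pn/10^4 ≤ p_c^bond(ℤ^d)` resp. `≤ p_c^site(ℤ^d)` — by `le_criticalProb_zd_of_chordRandWindowCert` /
  `le_siteCriticalProb_zd_of_nawRandWindowCert` with the soundness lemmas of `WinK`.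
-/

namespace Summit.CriticalPhenomena.PercolationContinuityZ3.Theorems.Pcint

open Finset Literature.Probability.Percolation Literature.Probability.LatticeModels

namespace WinK

/-! ### Integer weights -/

/-- Scaled B3r transition weight `DEN · p ((1-p) r)^c s̄^g κ̄^[cw]`, `DEN = 2·10^(8 + 8 cmax + 4 gmax)` (exact for
`c ≤ cmax`, `g ≤ gmax`). [folklore] -/
def termB (pn R S cmax gmax c g : ℕ) (cw : Bool) : ℕ :=
  pn * ((10 ^ 4 - pn) * R) ^ c * S ^ g * (if cw then 10 ^ 4 + S else 20000) * 10 ^ (8 * (cmax - c) + 4 * (gmax - g))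

/-- Scaled B2r transition weight `DEN · p q̄^g κ̄^[cw]`, `DEN = 2·10^(8 + 4 gmax)` (exact for `g ≤ gmax`). [folklore] -/
def termS (pn Q gmax g : ℕ) (cw : Bool) : ℕ :=
  pn * Q ^ g * (if cw then 10 ^ 4 + Q else 20000) * 10 ^ (4 * (gmax - g))

/-- **The B3r integer weight is exact.** [folklore] -/
theorem weightB_mul_den {pn R S cmax gmax c g : ℕ} (hpn : pn ≤ 10 ^ 4) (hc : c ≤ cmax) (hg : g ≤ gmax) (cw : Bool) :
    ((pn : ℝ) / 10 ^ 4) * (((1 - (pn : ℝ) / 10 ^ 4) * ((R : ℝ) / 10 ^ 4)) ^ c *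
      (((S : ℝ) / 10 ^ 4) ^ g * (if cw then ((10 ^ 4 + S : ℕ) : ℝ) / 20000 else 1))) *
        (2 * 10 ^ (8 + 8 * cmax + 4 * gmax)) = (termB pn R S cmax gmax c g cw : ℝ) := by
  obtain ⟨i, rfl⟩ := Nat.exists_eq_add_of_le hc
  obtain ⟨k, rfl⟩ := Nat.exists_eq_add_of_le hg
  rw [termB, Nat.add_sub_cancel_left, Nat.add_sub_cancel_left]
  simp only [Nat.cast_mul, Nat.cast_pow, Nat.cast_sub hpn, Nat.cast_ofNat, Nat.cast_add, Nat.cast_ite]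
  have h1 : (1 - (pn : ℝ) / 10 ^ 4) * ((R : ℝ) / 10 ^ 4) = ((10 ^ 4 - (pn : ℝ)) * R) / 10 ^ 8 := by ring
  have hq : ∀ n : ℕ, ((10 : ℝ) ^ 4) ^ n = ((10 : ℝ) ^ n) ^ 4 := fun n => by rw [← pow_mul, ← pow_mul, mul_comm]
  have hq8 : ∀ n : ℕ, ((10 : ℝ) ^ 8) ^ n = ((10 : ℝ) ^ n) ^ 8 := fun n => by rw [← pow_mul, ← pow_mul, mul_comm]
  rw [h1, div_pow, div_pow, hq8 c, hq g]
  have hTc : ((10 : ℝ) ^ c) ^ 8 ≠ 0 := by positivity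
  have hTg : ((10 : ℝ) ^ g) ^ 4 ≠ 0 := by positivity
  cases cw
  · simp only [Bool.false_eq_true, if_false]
    field_simp
    ring
  · simp only [if_true]
    field_simp
    ring

/-- **The B2r integer weight is exact.** [folklore] -/
theorem weightS_mul_den {pn Q gmax g : ℕ} (hg : g ≤ gmax) (cw : Bool) :
    ((pn : ℝ) / 10 ^ 4) * (((Q : ℝ) / 10 ^ 4) ^ g * (if cw then ((10 ^ 4 + Q : ℕ) : ℝ) / 20000 else 1)) *
      (2 * 10 ^ (8 + 4 * gmax)) = (termS pn Q gmax g cw : ℝ) := by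
  obtain ⟨k, rfl⟩ := Nat.exists_eq_add_of_le hg
  rw [termS, Nat.add_sub_cancel_left]
  simp only [Nat.cast_mul, Nat.cast_pow, Nat.cast_ofNat, Nat.cast_add, Nat.cast_ite]
  have hq : ∀ n : ℕ, ((10 : ℝ) ^ 4) ^ n = ((10 : ℝ) ^ n) ^ 4 := fun n => by rw [← pow_mul, ← pow_mul, mul_comm]
  rw [div_pow, hq g]
  have hTg : ((10 : ℝ) ^ g) ^ 4 ≠ 0 := by positivity
  cases cw
  · simp only [Bool.false_eq_true, if_false]
    field_simp
    ring
  · simp only [if_true]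
    field_simp
    ring

/-! ### Rows and per-code checks -/

section Rows

variable (d m pn R S Q lamN : ℕ) (tbl : List (ℕ × ℕ)) (dflt : ℕ)

/-- Certificate value of a window (table on normal forms). [folklore] -/
def vT (u : Fin (m + 1) → Fin d × Bool) : ℕ := lookupV tbl dflt u

/-- B3r denominator. [folklore] -/
def denB : ℕ := 2 * 10 ^ (8 + 8 * (m + 1) + 4 * (2 * d))

/-- B2r denominator. [folklore] -/
def denS : ℕ := 2 * 10 ^ (8 + 4 * (2 * d))

/-- One summand of the scaled B3r Collatz–Wielandt row, evaluated on the one-pass site list. [folklore] -/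
def rowTermB (u : Fin (m + 1) → Fin d × Bool) (a : Fin d × Bool) : ℕ :=
  let ps := sitesF u a
  if okcF ps then termB pn R S (m + 1) (2 * d) (ccF m ps) (gNF d m ps) (cNF d m ps a) * vT d m tbl dflt (wshift u a) else 0

/-- One summand of the scaled B2r Collatz–Wielandt row, evaluated on the one-pass site list. [folklore] -/
def rowTermS (u : Fin (m + 1) → Fin d × Bool) (a : Fin d × Bool) : ℕ :=
  let ps := sitesF u a
  if okNF m ps then termS pn Q (2 * d) (gNF d m ps) (cNF d m ps a) * vT d m tbl dflt (wshift u a) else 0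

/-- The B3r summand in terms of the reference tests `okc`, `cc`, `gN`, `cN`. [folklore] -/
theorem rowTermB_eq (u : Fin (m + 1) → Fin d × Bool) (a : Fin d × Bool) :
    rowTermB d m pn R S tbl dflt u a =
      if okc u a then termB pn R S (m + 1) (2 * d) (cc u a) (gN u a) (cN u a) * vT d m tbl dflt (wshift u a) else 0 := by
  simp only [rowTermB, sitesF_eq_sites, okcF_eq, ccF_eq, gNF_eq, cNF_eq]

/-- The B2r summand in terms of the reference tests `okN`, `gN`, `cN`. [folklore] -/
theorem rowTermS_eq (u : Fin (m + 1) → Fin d × Bool) (a : Fin d × Bool) :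
    rowTermS d m pn Q tbl dflt u a =
      if okN u a then termS pn Q (2 * d) (gN u a) (cN u a) * vT d m tbl dflt (wshift u a) else 0 := by
  simp only [rowTermS, sitesF_eq_sites, okNF_eq, gNF_eq, cNF_eq]

/-- Scaled B3r Collatz–Wielandt row of a window. [folklore] -/
def rowB (u : Fin (m + 1) → Fin d × Bool) : ℕ := ∑ a : Fin d × Bool, rowTermB d m pn R S tbl dflt u a

/-- Scaled B2r Collatz–Wielandt row of a window. [folklore] -/
def rowS (u : Fin (m + 1) → Fin d × Bool) : ℕ := ∑ a : Fin d × Bool, rowTermS d m pn Q tbl dflt u a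

/-- The B3r check on one window code: `10^5 · rowB ≤ lamN · DEN · v`. [folklore] -/
def rowOKB [NeZero d] (c : ℕ) : Bool :=
  decide (10 ^ 5 * rowB d m pn R S tbl dflt (decodeW d (m + 1) c) ≤ lamN * denB d m * vT d m tbl dflt (decodeW d (m + 1) c))

/-- The B2r check on one window code: `10^5 · rowS ≤ lamN · DEN · v`. [folklore] -/
def rowOKS [NeZero d] (c : ℕ) : Bool :=
  decide (10 ^ 5 * rowS d m pn Q tbl dflt (decodeW d (m + 1) c) ≤ lamN * denS d * vT d m tbl dflt (decodeW d (m + 1) c))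

end Rows

/-! ### The two generic bound theorems -/

/-- **Kernel B3r certificate ⇒ `pn/10^4 ≤ p_c^bond(ℤ^d)`.**  Integer side conditions: `pn ≤ 10^4`;
`S² + pn² ≥ 10^8` (`s̄ ≥ √(1-p²)`), `S ≤ 10^4`, `S R ≥ 10^8` (`s̄ r ≥ 1`), `(10^4 - pn) R ≤ 10^8` (`(1-p) r ≤ 1`);
`0 < lamN < 10^5`; table values in `[vlo, vhi]` with `vlo > 0`; and the row check on all codes. [folklore] -/
theorem le_criticalProb_of_checkB {d m pn R S lamN : ℕ} [NeZero d] {tbl : List (ℕ × ℕ)} {dflt vlo vhi : ℕ}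
    (hpn : pn ≤ 10 ^ 4) (hS : 10 ^ 8 ≤ S ^ 2 + pn ^ 2) (hS1 : S ≤ 10 ^ 4) (hS0 : 0 < S) (hR : 10 ^ 8 ≤ S * R)
    (hpr : (10 ^ 4 - pn) * R ≤ 10 ^ 8) (hlam0 : 0 < lamN) (hlam : lamN < 10 ^ 5)
    (htbl : ∀ e ∈ tbl, vlo ≤ e.2 ∧ e.2 ≤ vhi) (hdflt : vlo ≤ dflt ∧ dflt ≤ vhi) (hvlo : 0 < vlo)
    (hcheck : allRange (rowOKB d m pn R S lamN tbl dflt) 0 ((2 * d) ^ (m + 1)) = true) :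
    (pn : ℝ) / 10 ^ 4 ≤ criticalProb (zdGraph d) 0 := by
  have hp0 : (0 : ℝ) ≤ (pn : ℝ) / 10 ^ 4 := by positivity
  have hp1 : (pn : ℝ) / 10 ^ 4 ≤ 1 := by
    rw [div_le_one (by positivity)]; exact_mod_cast hpn
  set p : unitInterval := ⟨(pn : ℝ) / 10 ^ 4, hp0, hp1⟩ with hpdef
  have hpc : (p : ℝ) = (pn : ℝ) / 10 ^ 4 := rfl
  -- real forms of the integer side conditions
  have hSr : (10 : ℝ) ^ 8 ≤ (S : ℝ) ^ 2 + (pn : ℝ) ^ 2 := by exact_mod_cast hS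
  have hRr : (10 : ℝ) ^ 8 ≤ (S : ℝ) * R := by exact_mod_cast hR
  have hprr : ((10 ^ 4 - pn : ℕ) : ℝ) * R ≤ 10 ^ 8 := by exact_mod_cast hpr
  rw [Nat.cast_sub hpn] at hprr
  simp only [Nat.cast_pow, Nat.cast_ofNat] at hprr
  have hS0r : (0 : ℝ) < S := by exact_mod_cast hS0
  have hs0 : (0 : ℝ) < (S : ℝ) / 10 ^ 4 := by positivity
  have hsb1 : (S : ℝ) / 10 ^ 4 ≤ 1 := by rw [div_le_one (by positivity)]; exact_mod_cast hS1
  have hκb : (1 + (S : ℝ) / 10 ^ 4) / 2 ≤ ((10 ^ 4 + S : ℕ) : ℝ) / 20000 := by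
    apply le_of_eq; simp only [Nat.cast_add, Nat.cast_pow, Nat.cast_ofNat]; ring
  have hps : 1 - (p : ℝ) ^ 2 ≤ ((S : ℝ) / 10 ^ 4) ^ 2 := by
    rw [hpc]
    have h2 : (1 : ℝ) ≤ ((S : ℝ) ^ 2 + (pn : ℝ) ^ 2) / 10 ^ 8 := by rw [le_div_iff₀ (by positivity)]; linarith
    have h3 : ((S : ℝ) / 10 ^ 4) ^ 2 + ((pn : ℝ) / 10 ^ 4) ^ 2 = ((S : ℝ) ^ 2 + (pn : ℝ) ^ 2) / 10 ^ 8 := by ring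
    linarith
  have hsr : 1 ≤ (S : ℝ) / 10 ^ 4 * ((R : ℝ) / 10 ^ 4) := by
    rw [div_mul_div_comm, le_div_iff₀ (by positivity)]; linarith
  have hpr' : (1 - (p : ℝ)) * ((R : ℝ) / 10 ^ 4) ≤ 1 := by
    rw [hpc]
    have : (1 - (pn : ℝ) / 10 ^ 4) * ((R : ℝ) / 10 ^ 4) = ((10 ^ 4 - (pn : ℝ)) * R) / 10 ^ 8 := by ring
    rw [this, div_le_one (by positivity)]; exact hprr
  have hvlo' : (0 : ℝ) < vlo := by exact_mod_cast hvlo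
  have hlamr : (0 : ℝ) < lamN := by exact_mod_cast hlam0
  have hlam0' : (0 : ℝ) < (lamN : ℝ) / 10 ^ 5 := by positivity
  have hlam1' : (lamN : ℝ) / 10 ^ 5 < 1 := by rw [div_lt_one (by positivity)]; exact_mod_cast hlam
  -- every window satisfies its scaled row inequality
  have hrowN : ∀ u : Fin (m + 1) → Fin d × Bool,
      10 ^ 5 * rowB d m pn R S tbl dflt u ≤ lamN * denB d m * vT d m tbl dflt u := by
    intro u
    have := forall_of_allRange hcheck u
    rw [rowOKB, decodeW_encW, decide_eq_true_eq] at this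
    exact this
  rw [← hpc]
  refine le_criticalProb_zd_of_chordRandWindowCert (m := m) ((⟨0, NeZero.pos d⟩ : Fin d), true) okc cc gN cN hok hc
    (fun u a _ => hgN u a) (fun u a _ => hcN u a) p (s := (S : ℝ) / 10 ^ 4) (sb := (S : ℝ) / 10 ^ 4)
    (κb := ((10 ^ 4 + S : ℕ) : ℝ) / 20000) (r := (R : ℝ) / 10 ^ 4) hs0 le_rfl hsb1 hκb hps (by positivity) hsr hpr'
    (fun u => (vT d m tbl dflt u : ℝ)) (vmin := vlo) (vmax := vhi) (lam := (lamN : ℝ) / 10 ^ 5) hvlo'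
    (fun u => by exact_mod_cast (lookupV_bounds htbl hdflt u).1)
    (fun u => by exact_mod_cast (lookupV_bounds htbl hdflt u).2) hlam0' hlam1' fun u => ?_
  have hden : (0 : ℝ) < (denB d m : ℝ) := by unfold denB; positivity
  have hN : ((10 ^ 5 * rowB d m pn R S tbl dflt u : ℕ) : ℝ) ≤ ((lamN * denB d m * vT d m tbl dflt u : ℕ) : ℝ) := by
    exact_mod_cast hrowN u
  push_cast at hN
  -- the real row is the scaled row over the denominator
  have hrow : (∑ a : Fin d × Bool, if okc u a then
      (p : ℝ) * (((1 - p) * ((R : ℝ) / 10 ^ 4)) ^ cc u a *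
        (((S : ℝ) / 10 ^ 4) ^ gN u a * (if cN u a then ((10 ^ 4 + S : ℕ) : ℝ) / 20000 else 1))) *
        (vT d m tbl dflt (wshift u a) : ℝ) else 0) * (denB d m : ℝ) ≤ (rowB d m pn R S tbl dflt u : ℝ) := by
    rw [rowB, Nat.cast_sum, Finset.sum_mul]
    refine Finset.sum_le_sum fun a _ => le_of_eq ?_
    rw [rowTermB_eq]
    by_cases h : okc u a = true
    · simp only [h, if_true]
      rw [hpc, Nat.cast_mul, ← weightB_mul_den hpn (cc_le u a) (gN_le u a) (cN u a), denB]
      push_cast; ring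
    · simp [h]
  rw [← le_div_iff₀ hden] at hrow
  refine hrow.trans ?_
  rw [div_le_iff₀ hden]
  linarith [hN]

/-- **Kernel B2r certificate ⇒ `pn/10^4 ≤ p_c^site(ℤ^d)`.**  Integer side conditions: `pn ≤ 10^4`, `Q ≤ 10^4`,
`Q^{2d-1} · 10^4 ≥ (10^4 - pn) · 10^{4(2d-1)}` (`q̄^{2d-1} ≥ 1-p`); `0 < lamN < 10^5`; table values in `[vlo, vhi]`,
`vlo > 0`; and the row check on all codes. [folklore] -/
theorem le_siteCriticalProb_of_checkS {d m pn Q lamN : ℕ} [NeZero d] {tbl : List (ℕ × ℕ)} {dflt vlo vhi : ℕ}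
    (hpn : pn ≤ 10 ^ 4) (hQ1 : Q ≤ 10 ^ 4) (hQ : (10 ^ 4 - pn) * 10 ^ (4 * (2 * d - 1)) ≤ Q ^ (2 * d - 1) * 10 ^ 4)
    (hlam0 : 0 < lamN) (hlam : lamN < 10 ^ 5)
    (htbl : ∀ e ∈ tbl, vlo ≤ e.2 ∧ e.2 ≤ vhi) (hdflt : vlo ≤ dflt ∧ dflt ≤ vhi) (hvlo : 0 < vlo)
    (hcheck : allRange (rowOKS d m pn Q lamN tbl dflt) 0 ((2 * d) ^ (m + 1)) = true) :
    (pn : ℝ) / 10 ^ 4 ≤ siteCriticalProb (zdGraph d) 0 := by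
  have hp0 : (0 : ℝ) ≤ (pn : ℝ) / 10 ^ 4 := by positivity
  have hp1 : (pn : ℝ) / 10 ^ 4 ≤ 1 := by
    rw [div_le_one (by positivity)]; exact_mod_cast hpn
  set p : unitInterval := ⟨(pn : ℝ) / 10 ^ 4, hp0, hp1⟩ with hpdef
  have hpc : (p : ℝ) = (pn : ℝ) / 10 ^ 4 := rfl
  have hq0 : (0 : ℝ) ≤ (Q : ℝ) / 10 ^ 4 := by positivity
  have hqb1 : (Q : ℝ) / 10 ^ 4 ≤ 1 := by rw [div_le_one (by positivity)]; exact_mod_cast hQ1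
  have hκb : (1 + (Q : ℝ) / 10 ^ 4) / 2 ≤ ((10 ^ 4 + Q : ℕ) : ℝ) / 20000 := by push_cast; linarith
  have hpq : 1 - (p : ℝ) ≤ ((Q : ℝ) / 10 ^ 4) ^ (2 * d - 1) := by
    have hQr : ((10 ^ 4 - pn : ℕ) : ℝ) * 10 ^ (4 * (2 * d - 1)) ≤ (Q : ℝ) ^ (2 * d - 1) * 10 ^ 4 := by
      exact_mod_cast hQ
    rw [Nat.cast_sub hpn] at hQr
    simp only [Nat.cast_pow, Nat.cast_ofNat] at hQr
    rw [hpc, div_pow, ← pow_mul, le_div_iff₀ (by positivity)]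
    have : (1 - (pn : ℝ) / 10 ^ 4) * 10 ^ (4 * (2 * d - 1)) = (10 ^ 4 - (pn : ℝ)) * 10 ^ (4 * (2 * d - 1)) / 10 ^ 4 := by
      ring
    rw [this, div_le_iff₀ (by positivity)]
    exact hQr
  have hvlo' : (0 : ℝ) < vlo := by exact_mod_cast hvlo
  have hlamr : (0 : ℝ) < lamN := by exact_mod_cast hlam0
  have hlam0' : (0 : ℝ) < (lamN : ℝ) / 10 ^ 5 := by positivity
  have hlam1' : (lamN : ℝ) / 10 ^ 5 < 1 := by rw [div_lt_one (by positivity)]; exact_mod_cast hlam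
  have hrowN : ∀ u : Fin (m + 1) → Fin d × Bool,
      10 ^ 5 * rowS d m pn Q tbl dflt u ≤ lamN * denS d * vT d m tbl dflt u := by
    intro u
    have := forall_of_allRange hcheck u
    rw [rowOKS, decodeW_encW, decide_eq_true_eq] at this
    exact this
  rw [← hpc]
  refine le_siteCriticalProb_zd_of_nawRandWindowCert (m := m) ((⟨0, NeZero.pos d⟩ : Fin d), true) okN gN cN hokN
    (fun u a _ _ => hgN u a) (fun u a _ _ => hcN u a) p (q := (Q : ℝ) / 10 ^ 4) (qb := (Q : ℝ) / 10 ^ 4)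
    (κb := ((10 ^ 4 + Q : ℕ) : ℝ) / 20000) hq0 le_rfl hqb1 hκb hpq
    (fun u => (vT d m tbl dflt u : ℝ)) (vmin := vlo) (vmax := vhi) (lam := (lamN : ℝ) / 10 ^ 5) hvlo'
    (fun u => by exact_mod_cast (lookupV_bounds htbl hdflt u).1)
    (fun u => by exact_mod_cast (lookupV_bounds htbl hdflt u).2) hlam0' hlam1' fun u => ?_
  have hden : (0 : ℝ) < (denS d : ℝ) := by unfold denS; positivity
  have hN : ((10 ^ 5 * rowS d m pn Q tbl dflt u : ℕ) : ℝ) ≤ ((lamN * denS d * vT d m tbl dflt u : ℕ) : ℝ) := by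
    exact_mod_cast hrowN u
  push_cast at hN
  have hrow : (∑ a : Fin d × Bool, if okN u a then
      (p : ℝ) * (((Q : ℝ) / 10 ^ 4) ^ gN u a * (if cN u a then ((10 ^ 4 + Q : ℕ) : ℝ) / 20000 else 1)) *
        (vT d m tbl dflt (wshift u a) : ℝ) else 0) * (denS d : ℝ) ≤ (rowS d m pn Q tbl dflt u : ℝ) := by
    rw [rowS, Nat.cast_sum, Finset.sum_mul]
    refine Finset.sum_le_sum fun a _ => le_of_eq ?_
    rw [rowTermS_eq]
    by_cases h : okN u a = true
    · simp only [h, if_true]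
      rw [hpc, Nat.cast_mul, ← weightS_mul_den (gN_le u a) (cN u a), denS]
      push_cast; ring
    · simp [h]
  rw [← le_div_iff₀ hden] at hrow
  refine hrow.trans ?_
  rw [div_le_iff₀ hden]
  linarith [hN]

end WinK

end Summit.CriticalPhenomena.PercolationContinuityZ3.Theorems.Pcint
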